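import Summits.BirchSwinnertonDyer.Rank1Residual.X11b.KolyvaginHpointsAssemblyAt
import Summits.BirchSwinnertonDyer.Rank1Residual.X11b.KolyvaginProp53OfReciprocity
import Literature.NumberTheory.EllipticCurves.HeegnerPointsOfConductorGaloisOrbitProofs
import Literature.NumberTheory.EllipticCurves.HeegnerPointsOfConductorRationalityProofs
import Literature.NumberTheory.EllipticCurves.HeegnerPointsOfConductorOneGaloisConjProofs
import HarnessLib

/-!
# The cite-only leaf inputs `hCM` and `h53` of the X11b Kolyvagin ENDs DISCHARGED (any prime `p`),
# and leaf (A′) at one prime from {`hGZ`, `hγ`} alone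

Cell `b2b-bsdres`, team x11b3 (N8/O2 = X11b @ 3); seat x11b3-p2 GEN 52 (unit claimed D-0075 →
BSD:K2/P4 «Kolyvagin-in-kernel»).  Summit-side THEOREM-ONLY file (no definition, no named fact,
no `sorry`); `K : Type`; ONE generic prime `p`.

HONEST FRAMING (cell `b2b-bsdres`, binding): the goal of the cell is to DELETE the
COMBINATION-SHAPED residual classes of the Birch–Swinnerton-Dyer formula for ALL analytic-rank
`≤ 1` elliptic curves over `ℚ` — assembled STRICTLY from published theorems — so that the
rank-`≤ 1` remainder becomes exactly the CONSTRUCTION-SHAPED classes, which are TYPED, NOT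
attempted.  This is not "finishing BSD"; the X11b @ 3 class stays OPEN; nothing here is booked;
no mark / label / count / tier moves.

WHAT THIS FILE DOES.  Every X11b Kolyvagin END of the tree (`KolyvaginAssembly.hpoints_at_of_
perLevelChoice` and its telescopes `KolyvaginShaFiniteAtPrime`, `KolyvaginShaExponentAtPrime`,
`KolyvaginShaAnnihilatorAtPrime`, `KolyvaginShaOrder*`, `Three/KolyvaginSha*Three*`) carries the
same five LABELLED cite-only inputs at the prime `p`:
* `hrec` — Shimura reciprocity at conductor `1` = the named fact
  `heegnerPointOfConductor_one_galoisConj N W K` (Gross 1984 §5 / Darmon 2004 Thm. 3.7 at `𝒪_K`);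
* `hCM` — Gross 1991 §3 CM rationality `y(m) = φ(x(m)) ∈ E(K[m])` at the square-free Kolyvagin
  levels `m` of `(p, M)` (Darmon 2004 Thm. 3.6);
* `h53` — Gross 1991 Prop. 5.3 at conductor `m`: `y_m^τ = ε·y_m^{σ′} + torsion`, `ε = −w(E)`;
* `hGZ` — [GZ86 III (3.1)] (`y ∈ E⁰` up to prime-to-`p` torsion) at the levels of `(p, M)`;
* `hγ` — Gross 1991 Prop. 3.7 (2), the Eichler–Shimura congruence `y_m ≡ Frob·y_{m/ℓ}`.
Since 2026-08-27 THREE of them are KERNEL THEOREMS of the tree's `Literature/` (cells `bsd-jet`,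
`bsd-cited`, `bsd-stepL`; complex multiplication on the tree's model of `X₀(N)`):
* `hrec` = `heegnerPointOfConductor_one_galoisConj_holds N W K`
  (`HeegnerPointsOfConductorOneGaloisConjProofs`);
* `hCM` ⇐ `phi_heegnerPointOfConductor_mem_range_map_ringClassField_holds N W K`
  (`HeegnerPointsOfConductorRationalityProofs`: `y(n) ∈ E(K[n])` for EVERY `n ≠ 0` prime to `N`);
* `h53` ⇐ this seat's reduction `KolyvaginA53.h53_of_recM_of_eq_conductorNorm`
  (`KolyvaginProp53OfReciprocity`, p418932: Prop. 5.3 from Shimura reciprocity at conductor `m`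
  + Atkin–Lehner + Manin–Drinfeld + `φ(−τ̄) = conj φ(τ)`) fed with
  `exists_mem_ringClassGal_map_pointGalHom_y_eq_of_heegnerHypothesis`
  (`HeegnerPointsOfConductorGaloisOrbitProofs`, p507418: the VERBATIM shape of its binder `hrecM`).
(The Poitou–Tate label `hPT` of the telescopes is likewise the tree theorem
`GaloisCohomology.poitouTate_sum_localTatePairing_eq_zero_holds K`.)  THIS FILE states the two
discharges `hCM_holds` / `h53_holds` in EXACTLY the binder shapes of the ENDs (generic level `N`,
model `W`, field `K`, prime `p`; the only side step is that a square-free product `m` of Kolyvagin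
primes `ℓ ∤ N` is `≠ 0` and prime to `N`), so that any consumer closes those binders BY NAME, and
re-issues the per-prime root END `hpoints_at_of_perLevelChoice` CONDITIONAL on EXACTLY the TWO
remaining cite-only inputs {`hGZ`, `hγ`} at `p` (+ `hN`): `hpoints_at_of_perLevelChoice_of_GZ_of_gamma`.
Nothing else changes: `hGZ` (discharged on the Kodaira–Néron sub-class by `KolyvaginHloc.
hGZ_of_kodairaNeron`, p319336, else cite-only) and `hγ` (cite-only) stay labelled hypotheses;
node `Three.HsiehDescentAt₃` and its antecedents untouched; nothing booked.

## What is proved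

* `KolyvaginLeaves.ne_zero_and_coprime_of_kolyvaginLevel` — a divisor `m` of a square-free
  product `n` of Kolyvagin primes is `≠ 0` and prime to `N` (side step).
* **`KolyvaginLeaves.hCM_holds`** — the `hCM` binder at `(N, W, K, p)`, PROVED.
* **`KolyvaginLeaves.h53_holds`** — the `h53` binder at `(N, W, K, p)` for `N = N_E`, PROVED.
* **`KolyvaginAssembly.hpoints_at_of_perLevelChoice_of_GZ_of_gamma`** — leaf (A′) at one prime
  (the `hpoints` binder of `KolyvaginDescent.sha_primary_finite_at_of_pointsM_of_reciprocityM`,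
  verbatim) from {`hGZ`, `hγ`} at `p` alone.

## References

* [GrossLMS1991] B. H. Gross, *Kolyvagin's work on modular elliptic curves*, LMS LNS 153 (1991),
  §3 (pp. 238–239), Prop. 3.7, §5 (5.2), Prop. 5.3 (held `book:editornd-l-functions-arithmetic`,
  chunks 215–220).
* [Darmon2004] H. Darmon, *Rational Points on Modular Elliptic Curves*, CBMS 101 (2004), Thm. 3.6,
  Thm. 3.7, Prop. 3.11.
* [Gross1984] B. H. Gross, *Heegner points on `X₀(N)`*, in *Modular Forms* (Durham 1983), §I.1, §5.
* [McCallumLMS1991] W. G. McCallum, *Kolyvagin's work on Shafarevich–Tate groups*, same volume,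
  §1 Theorem (per prime), §4.
* [GrossZagier1986] B. H. Gross, D. Zagier, *Heegner points and derivatives of `L`-series*,
  Invent. Math. 84 (1986), III (3.1).

presearch: `lean search 'hCM_holds|h53_holds|KolyvaginLeaves'` → none; the discharging theorems
are the tree's (`lean search 'heegnerPointOfConductor_one_galoisConj_holds'`,
`'phi_heegnerPointOfConductor_mem_range_map_ringClassField_holds'`,
`'exists_mem_ringClassGal_map_pointGalHom_y_eq_of_heegnerHypothesis'` → one decl each, 2026-08-27);
literature = the sources those modules cite ([corpus:book:editornd-l-functions-arithmetic chunk
215 L15 – chunk 216 L9; chunk 220 L11–L16]); no fact minted.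
-/

noncomputable section

open scoped Classical
open WeierstrassCurve Field NumberField IsDedekindDomain Finset
open Literature.NumberTheory.EllipticCurves Literature.NumberTheory.GaloisRepresentations
open Literature.NumberTheory.EllipticCurves.KolyvaginCocycle
open Literature.NumberTheory.EllipticCurves.KolyvaginEuler
open Literature.NumberTheory.EllipticCurves.RingClassField
open Literature.NumberTheory.EllipticCurves.ModularForms

namespace Summit.BirchSwinnertonDyer.Rank1Residual.X11b.KolyvaginLeaves

-- `K : Type`: the tree's ring-class class field theory is universe `0`.
variable {K : Type} [Field K] [NumberField K] {N : ℕ} {W : WeierstrassCurve ℚ}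

/-- **Side step: a Kolyvagin level is `≠ 0` and prime to `N`.**  If `n` is square-free and every
prime factor of `n` is a Kolyvagin prime for `(N, W, K, p)` (in particular `ℓ ∤ N`,
Gross 1991 (3.1)), then every `m ∣ n` is `≠ 0` and `Nat.Coprime m N`.
[cite: GrossLMS1991, §3 (3.1)] -/
theorem ne_zero_and_coprime_of_kolyvaginLevel {p M n m : ℕ} (hn : Squarefree n)
    (hKol : ∀ q ∈ n.primeFactors, IsKolyvaginPrime N W K p q ∧ FrobEqFrobInfty W K (p ^ M) q)
    (hm : m ∣ n) : m ≠ 0 ∧ m.Coprime N :=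
  ⟨ne_zero_of_dvd_ne_zero (Squarefree.ne_zero hn) hm,
    Nat.coprime_of_dvd fun k hk hkm hkN ↦ (hKol k (Nat.mem_primeFactors.mpr
      ⟨hk, hkm.trans hm, Squarefree.ne_zero hn⟩)).1.2.1 hkN⟩

/-- **`hCM` DISCHARGED — Gross 1991 §3 / Darmon 2004 Thm. 3.6: `y(m) = φ(x(m)) ∈ E(K[m])` at
every square-free Kolyvagin level `m` of `(p, M)`**, in EXACTLY the shape of the `hCM` binder of
the X11b Kolyvagin ENDs (`KolyvaginAssembly.hpoints_at_of_perLevelChoice` and its telescopes) at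
`(N, W, K, p)`: for `E = W/ℚ` elliptic, `K` imaginary quadratic with the Heegner hypothesis for
`N`, a parametrisation datum `Dt` at level `N`, an orientation `β` (`4N ∣ β² − d_K`), `ι : K → ℂ`,
`M ≥ 1` and `m` square-free with all prime factors Kolyvagin primes of `(p, M)`, some point of
`E(K[m])` maps to `y(m) ∈ E(ℂ)`.  Proof: the tree THEOREM
`phi_heegnerPointOfConductor_mem_range_map_ringClassField_holds N W K` (every `m ≠ 0` prime to
`N`) at the level `m` (`≠ 0`, prime to `N` by `ne_zero_and_coprime_of_kolyvaginLevel`).  No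
cite-only input remains in this binder.
[cite: GrossLMS1991, §3 (p. 238: x_n rational over K_n; y_n = φ(x_n) ∈ E(K_n))]
[cite: Darmon2004, Thm. 3.6 (PDF pp. 43–44)] -/
theorem hCM_holds (N : ℕ) [NeZero N] (W : WeierstrassCurve ℚ) (K : Type) [Field K] [NumberField K]
    (p : ℕ) :
    ∀ [W.IsElliptic] (_hK : IsImaginaryQuadratic K) (_hH : SatisfiesHeegnerHypothesis N K)
      (Dt : ModularParametrizationData W N) (β : ℤ) (ι : K →+* ℂ),
      (4 * N : ℤ) ∣ β ^ 2 - NumberField.discr K →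
      ∀ {M : ℕ}, 1 ≤ M → ∀ (m : ℕ), Squarefree m →
      (∀ q ∈ m.primeFactors, IsKolyvaginPrime N W K p q ∧ FrobEqFrobInfty W K (p ^ M) q) →
      ∃ y : (W.baseChange (ringClassField K ι m)).toAffine.Point,
        WeierstrassCurve.Affine.Point.map (W' := W) (ringClassField K ι m).subtype.toRatAlgHom y =
          heegnerPointComplexOfConductor Dt (NumberField.discr K) β m := by
  intro _ hK hH Dt β ι hβ M _ m hm hKol
  obtain ⟨hm0, hmN⟩ := ne_zero_and_coprime_of_kolyvaginLevel (N := N) (W := W) (K := K) hm hKol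
    (dvd_refl m)
  exact phi_heegnerPointOfConductor_mem_range_map_ringClassField_holds N W K hK hH Dt β ι m hβ
    hm0 hmN

/-- **`h53` DISCHARGED — Gross 1991 Prop. 5.3 at conductor `m`: `y_m^τ = ε·y_m^{σ′} + torsion`,
`ε = −w(E)`, at every Kolyvagin level of `(p, M)`**, in EXACTLY the shape of the `h53` binder of
the X11b Kolyvagin ENDs at `(N, W, K, p)`, for a level `N = N_E` (`hN`, as in every END): for
`E = W/ℚ` elliptic, `K` imaginary quadratic Heegner for `N`, `Dt`, `β`, `ι`, `M ≥ 1`, `n`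
square-free with Kolyvagin prime factors, per-level Kolyvagin–Heegner data `d`, a level `m ∣ n`
and any `τ_m ∈ Aut(K[m])` acting as complex conjugation, some `σ′ ∈ 𝒢_m` has
`τ_m y(m) − ε σ′ y(m)` of finite order.  Proof: this seat's reduction
`KolyvaginA53.h53_of_recM_of_eq_conductorNorm` (Prop. 5.3 ⇐ Shimura reciprocity at conductor `m`,
with Atkin–Lehner, Manin–Drinfeld and `φ(−τ̄) = conj φ(τ)` from the tree) whose ONLY labelled input
`hrecM` is now the tree THEOREM `exists_mem_ringClassGal_map_pointGalHom_y_eq_of_heegnerHypothesis`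
(Darmon 2004 Thm. 3.7 in orbit form, proved on the tree's model of `X₀(N)`); `4N ∣ β² − d_K` from
the datum's `dvd_sq_sub`; `m ≠ 0` prime to `N` by `ne_zero_and_coprime_of_kolyvaginLevel`.  No
cite-only input remains in this binder.
[cite: GrossLMS1991, §5 Prop. 5.3 and proof, (5.2) (PDF p. 220)]
[cite: Darmon2004, Thm. 3.7 (PDF p. 44), Prop. 3.11] [cite: Gross1984, §I.1, §5] -/
theorem h53_holds [NeZero N] (hN : N = W.conductorNorm ℤ) (p : ℕ) :
    ∀ [W.IsElliptic] (_hK : IsImaginaryQuadratic K) (_hH : SatisfiesHeegnerHypothesis N K)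
      (Dt : ModularParametrizationData W N) (β : ℤ) (ι : K →+* ℂ) {M : ℕ}
      (_hM : 1 ≤ M) {n : ℕ} (_hn : Squarefree n)
      (_hKol : ∀ q ∈ n.primeFactors, IsKolyvaginPrime N W K p q ∧ FrobEqFrobInfty W K (p ^ M) q)
      (d : (m : ℕ) → m ∣ n → KolyvaginHeegnerData Dt β ι m) (m : ℕ) (hm : m ∣ n)
      (τm : ringClassField K ι m ≃ₐ[ℚ] ringClassField K ι m),
      (∀ x : ringClassField K ι m, ((τm x : ringClassField K ι m) : ℂ) = starRingEnd ℂ x) →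
      ∃ σ' ∈ ringClassGal ι m, IsOfFinAddOrder
        (pointGalHom W (ringClassField K ι m) τm (d m hm).y -
          (-W.rootNumber) • pointGalHom W (ringClassField K ι m) σ' (d m hm).y) := by
  intro _ hK hH Dt β ι M _ n hn hKol d m hm τm hτm
  obtain ⟨hm0, hmN⟩ := ne_zero_and_coprime_of_kolyvaginLevel (N := N) (W := W) (K := K) hn hKol hm
  exact KolyvaginA53.h53_of_recM_of_eq_conductorNorm hN hK hH Dt ι (d m hm).dvd_sq_sub hm0 hmN
    (d m hm) (fun _ hQ hQβ ↦ exists_mem_ringClassGal_map_pointGalHom_y_eq_of_heegnerHypothesis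
      hK ι hH Dt hm0 hmN (d m hm) hQ hQβ) τm hτm

end Summit.BirchSwinnertonDyer.Rank1Residual.X11b.KolyvaginLeaves

namespace Summit.BirchSwinnertonDyer.Rank1Residual.X11b.KolyvaginAssembly

-- `K : Type`: the tree's ring-class class field theory is universe `0`.
variable {K : Type} [Field K] [NumberField K] {N : ℕ} {W : WeierstrassCurve ℚ}

/-- **Leaf (A′) AT ONE PRIME — the `hpoints` binder of
`KolyvaginDescent.sha_primary_finite_at_of_pointsM_of_reciprocityM` — from {`hGZ`, `hγ`} at `p`
ALONE** (Gross 1991 §§3–6, McCallum 1991 §4): `hpoints_at_of_perLevelChoice` (x11b3-p2 GEN 35,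
p321380) with its labels `hrec`, `hCM`, `h53` SUPPLIED by the tree theorems
`heegnerPointOfConductor_one_galoisConj_holds`, `KolyvaginLeaves.hCM_holds`,
`KolyvaginLeaves.h53_holds`; conclusion VERBATIM (for every `M ≥ 1`, `hdiv`, `c ≠ 1`: the data
`(ε, τ, A, P_m)` with clauses (a)–(f)).  For `E = W/ℚ` globally minimal and elliptic at its
conductor `N` (`hN`), `K` imaginary quadratic with `d_K ∉ {−3, −4}` and the Heegner hypothesis,
`P` a Heegner point, `p` odd with `ρ̄_{E,p}` onto.  CONDITIONAL on EXACTLY the TWO labelled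
cite-only inputs {`hGZ` ([GZ86 III (3.1)] at `p`), `hγ` (Gross Prop. 3.7 (2) at `p`)}; nothing
booked; no mark / label / count / tier moves.
[cite: GrossLMS1991, §3, Prop. 3.7 (2), §4 (4.1), Lemma 4.3, Props. 5.3, 5.4 (1), 6.2 (1)]
[cite: McCallumLMS1991, §1 Theorem (Kolyvagin), §4 (4)–(6), Lemma 4.3, Prop. 4.4]
[cite: GrossZagier1986, III (3.1)] [cite: Darmon2004, Thm. 3.6, Thm. 3.7, Prop. 3.11] -/
theorem hpoints_at_of_perLevelChoice_of_GZ_of_gamma [NeZero N] [W.IsGloballyMinimal]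
    [W.IsElliptic] (hN : N = W.conductorNorm ℤ) (hK : IsImaginaryQuadratic K)
    (hD34 : NumberField.discr K ≠ -3 ∧ NumberField.discr K ≠ -4)
    (hH : SatisfiesHeegnerHypothesis N K) {P : (W.baseChange K).toAffine.Point}
    (hHP : IsHeegnerPoint N W K P) {p : ℕ} (hp : p.Prime) (hp2 : p ≠ 2)
    (hρ : W.HasSurjectiveModNGaloisRep p)
    (hGZ : ∀ [W.IsElliptic] (_hK : IsImaginaryQuadratic K) (_hH : SatisfiesHeegnerHypothesis N K)
      (Dt : ModularParametrizationData W N) (β : ℤ) (ι : K →+* ℂ) {M : ℕ} (_hM : 1 ≤ M) {n : ℕ}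
      (_hn : Squarefree n)
      (_hKol : ∀ q ∈ n.primeFactors, IsKolyvaginPrime N W K p q ∧ FrobEqFrobInfty W K (p ^ M) q)
      (d : (m : ℕ) → m ∣ n → KolyvaginHeegnerData Dt β ι m),
      ∃ n' : ℤ, IsCoprime ((p ^ M : ℕ) : ℤ) n' ∧
        ∀ (m : ℕ) (hm : m ∣ n) (γ : ringClassField K ι m ≃ₐ[ℚ] ringClassField K ι m),
          γ ∈ ringClassGal ι m → ∀ v : HeightOneSpectrum (𝓞 K),
            ¬ (W.baseChange K).HasGoodReductionAt v →
            n' • pointsMap (W.baseChange K) (v.adicCompletion K)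
                ((d m hm).toGeomPoints (pointGalHom W (ringClassField K ι m) γ (d m hm).y)) ∈
              E0Receptacle (W.baseChange K) v ∧
            ∀ (ℓ : ℕ) (hℓ : ℓ ∈ m.primeFactors)
              (hle : ringClassField K ι (m / ℓ) ≤ ringClassField K ι m),
              n' • pointsMap (W.baseChange K) (v.adicCompletion K)
                  ((d m hm).toGeomPoints (pointGalHom W (ringClassField K ι m) γ
                    (WeierstrassCurve.Affine.Point.map (W' := W)
                      ((RingClassField.inclusion ι hle).restrictScalars ℚ)
                      (d (m / ℓ)
                        ((Nat.div_dvd_of_dvd (Nat.dvd_of_mem_primeFactors hℓ)).trans hm)).y))) ∈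
                E0Receptacle (W.baseChange K) v)
    (hγ : ∀ [W.IsElliptic] (_hK : IsImaginaryQuadratic K) (_hH : SatisfiesHeegnerHypothesis N K)
      (Dt : ModularParametrizationData W N) (β : ℤ) (ι : K →+* ℂ) {M : ℕ}
      (_hM : 1 ≤ M) {n : ℕ} (_hn : Squarefree n)
      (_hKol : ∀ q ∈ n.primeFactors, IsKolyvaginPrime N W K p q ∧ FrobEqFrobInfty W K (p ^ M) q)
      (d : (m : ℕ) → m ∣ n → KolyvaginHeegnerData Dt β ι m)
      (m : ℕ) (hm : m ∣ n) (ℓ : ℕ) (hℓ : ℓ ∈ m.primeFactors) [Fact ℓ.Prime]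
      (hΔ : ¬ (ℓ : ℤ) ∣ minimalDiscriminantInt W) (φ₀ : absoluteGaloisGroup (ZMod ℓ)),
      (∀ x : AlgebraicClosure (ZMod ℓ), φ₀ • x = x ^ ℓ) →
      ∀ (hle : ringClassField K ι (m / ℓ) ≤ ringClassField K ι m)
        (γ : ringClassField K ι m ≃ₐ[ℚ] ringClassField K ι m), γ ∈ ringClassGal ι m →
        geomReduction hΔ ((RatClosure.pointsEquiv (K := K) W).symm
            ((d m hm).toGeomPoints (pointGalHom W (ringClassField K ι m) γ (d m hm).y))) =
          φ₀ • geomReduction hΔ ((RatClosure.pointsEquiv (K := K) W).symm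
            ((d m hm).toGeomPoints (pointGalHom W (ringClassField K ι m) γ
              (WeierstrassCurve.Affine.Point.map (W' := W)
                ((RingClassField.inclusion ι hle).restrictScalars ℚ)
                (d (m / ℓ)
                  ((Nat.div_dvd_of_dvd (Nat.dvd_of_mem_primeFactors hℓ)).trans hm)).y))))) :
    ∀ {M : ℕ} (_hM : 1 ≤ M)
      (hdiv : ∀ Q : geomPoints (W.baseChange K), ∃ R, ((p ^ M : ℕ) : ℤ) • R = Q)
      (c : K ≃ₐ[ℚ] K) (_hc : c ≠ 1),
      ∃ (ε : ℤ) (τ : AlgebraicClosure K ≃+* AlgebraicClosure K) (hτ : IsLiftOfAut c τ)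
        (A : ℕ → AddSubgroup (geomPoints (W.baseChange K)))
        (hA : ∀ m, KolyvaginCocycle.IsAdmissible (Field.absoluteGaloisGroup K) (A m)
          ((p ^ M : ℕ) : ℤ))
        (Pt : ℕ → geomPoints (W.baseChange K))
        (hPt : ∀ m, Pt m ∈
          KolyvaginCocycle.invPoints (Field.absoluteGaloisGroup K) (A m) ((p ^ M : ℕ) : ℤ)),
        (ε = 1 ∨ ε = -1) ∧
        IsOfFinAddOrder (Affine.Point.map (W' := W) (c : K →ₐ[ℚ] K) P - ε • P) ∧
        (∀ m, ∀ a ∈ A m, hτ.pointsMap W a ∈ A m) ∧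
        Pt 1 = toGeomPoints (W.baseChange K) P ∧
        (∀ m : ℕ, Squarefree m →
          (∀ q ∈ m.primeFactors, IsKolyvaginPrime N W K p q ∧ FrobEqFrobInfty W K (p ^ M) q) →
          (∃ B ∈ A m, hτ.pointsMap W (Pt m) =
            (ε * (-1) ^ m.primeFactors.card) • Pt m + ((p ^ M : ℕ) : ℤ) • B) ∧
          (∀ v : HeightOneSpectrum (𝓞 K), (m : 𝓞 K) ∉ v.asIdeal →
            kolyvaginClass (W.baseChange K) _ hdiv (hA m) (Pt m) (hPt m) ∈
              selmerLocalKer (W.baseChange K) (v.adicCompletion K) ((p ^ M : ℕ) : ℤ)) ∧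
          (∀ ℓ : ℕ, ℓ.Prime → ℓ ∣ m → ∀ v : HeightOneSpectrum (𝓞 K), (ℓ : 𝓞 K) ∈ v.asIdeal →
            ∀ a : ℕ, (((p : ℤ) ^ a) •
                kolyvaginClass (W.baseChange K) _ hdiv (hA m) (Pt m) (hPt m) ∈
                selmerLocalKer (W.baseChange K) (v.adicCompletion K) ((p ^ M : ℕ) : ℤ) ↔
              ((p : ℤ) ^ a) • kolyvaginClass (W.baseChange K) _ hdiv (hA (m / ℓ)) (Pt (m / ℓ))
                  (hPt (m / ℓ)) ∈
                (W.baseChange K).torsionLocalKer (v.adicCompletion K) ((p ^ M : ℕ) : ℤ)))) :=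
  hpoints_at_of_perLevelChoice hN hK hD34 hH hHP hp hp2 hρ
    (heegnerPointOfConductor_one_galoisConj_holds N W K) (KolyvaginLeaves.hCM_holds N W K p)
    (KolyvaginLeaves.h53_holds hN p) hGZ hγ

end Summit.BirchSwinnertonDyer.Rank1Residual.X11b.KolyvaginAssembly

end
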